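import Mathlib
import HarnessLib
import Literature.Geometry.Lorentzian.InverseMeanCurvatureFlowWeakGradient

/-!
# Route `IntegerScrew` — the WINDOW FLOOR is the reciprocal of a resolvent entry:
# `min { cᵀBc : c_{i₀} = 1 } = 1/(B⁻¹)_{i₀i₀}` for a positive definite `B` (PIVOT-LAW 13.10 (v) / 13.3:
# `f_M(a) := min_{c_1 = 1} [a‖c‖² − cᵀN_Mc] = 1/[(a − N_M)⁻¹]₁₁`)

PIVOT-LAW §13 (rh-explicit, A6-PIVOT theory) defines the per-window floor of the intercept problem as the
constrained minimum `f_M(a) = min { a‖c‖² − cᵀN_M c : c real on [1, M], c_1 = 1 }` (`N_M` the von Mangoldt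
coupling matrix) and uses, for `a > ν_max(N_M)`, the identity `f_M(a) = 1/[(aI − N_M)⁻¹]₁₁` («complete the
square», 13.3) — which, combined with `IntegerScrewResolventLaplace` (`[(aI − N)⁻¹]₁₁ = ∫₀^∞e^{−at}(e^{tN})₁₁dt`),
turns the floor into the Laplace transform of the return probability of the multiplicative walk (13.10 (v)),
the bridge through which THEOREM C♯ yields THEOREM N6₁ (13.45).  This file proves the identity as generic
linear algebra over a finite index type, for a positive definite real matrix `B` and a distinguished index
`i₀`:

* `form_ge_inv_of_apply_eq_one` — `c_{i₀} = 1 ⇒ cᵀBc ≥ 1/(B⁻¹)_{i₀i₀}`;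
* `inv_apply_self_pos` — `(B⁻¹)_{i₀i₀} > 0`; `inv_apply_self_eq_form` — `(B⁻¹)_{i₀i₀} = uᵀBu`, `u := B⁻¹e_{i₀}`;
* `exists_form_eq_inv_of_apply_eq_one` — the minimum is ATTAINED, at `c⋆ = B⁻¹e_{i₀}/(B⁻¹)_{i₀i₀}`;
* `isLeast_form_apply_eq_one` — hence `1/(B⁻¹)_{i₀i₀}` is the least value of `cᵀBc` over `c_{i₀} = 1`;
* `isLeast_windowForm` — the same for `B = a·1 − N`: the least value of `a‖c‖² − cᵀNc` over `c_{i₀} = 1` is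
  `1/((a·1 − N)⁻¹)_{i₀i₀}` whenever `a·1 − N` is positive definite.

Proof: with `u = B⁻¹e_{i₀}` one has `Bu = e_{i₀}`, `uᵀBu = u_{i₀} = (B⁻¹)_{i₀i₀} =: β > 0`, and for `c_{i₀} = 1`,
`cᵀBu = c_{i₀} = 1`; expanding `0 ≤ (c − u/β)ᵀB(c − u/β) = cᵀBc − 2/β + 1/β` gives the bound, with equality at
`c = u/β` (the symmetry `xᵀBy = yᵀBx` is the tree's
`Literature.Geometry.Lorentzian.dotProduct_mulVec_comm_of_isHermitian`).  RH-free, walk-free: elementary linear algebra; nothing here bears on the truth of RH.  References: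
PIVOT-LAW §13.3, §13.10 (v), §13.45 (rh-explicit A6-PIVOT); M. Suzuki, J. Lond. Math. Soc. (2) 108 (2023)
1448–1487 [Suzuki2023] for the screw matrices whose pivot law this serves.
-/

noncomputable section

-- D-0017: `Summit.<S>.<S>.…` is the designed namespace of a single-problem summit.
set_option linter.dupNamespace false

namespace Summit.RiemannHypothesis.RiemannHypothesis.Theorems.IntegerScrew

open Matrix Finset

variable {ι : Type*} [Fintype ι]

/-- Expansion of the quadratic form of a real symmetric matrix at a difference:
`(c − λu)ᵀB(c − λu) = cᵀBc − 2λ·cᵀBu + λ²·uᵀBu`. -/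
theorem form_sub_smul_eq {B : Matrix ι ι ℝ} (hB : B.IsHermitian) (c u : ι → ℝ) (lam : ℝ) :
    (c - lam • u) ⬝ᵥ (B *ᵥ (c - lam • u)) =
      c ⬝ᵥ (B *ᵥ c) - 2 * lam * (c ⬝ᵥ (B *ᵥ u)) + lam ^ 2 * (u ⬝ᵥ (B *ᵥ u)) := by
  have hsym := Literature.Geometry.Lorentzian.dotProduct_mulVec_comm_of_isHermitian hB u c
  rw [mulVec_sub, mulVec_smul, sub_dotProduct, dotProduct_sub, dotProduct_sub, smul_dotProduct,
    smul_dotProduct, dotProduct_smul, dotProduct_smul, hsym]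
  simp only [smul_eq_mul]
  ring

variable [DecidableEq ι]

section PosDef

variable {B : Matrix ι ι ℝ}

/-- `u := B⁻¹e_{i₀}` solves `Bu = e_{i₀}` when `B` is positive definite. -/
theorem mulVec_inv_mulVec_single (hB : B.PosDef) (i₀ : ι) :
    B *ᵥ (B⁻¹ *ᵥ Pi.single i₀ 1) = Pi.single i₀ 1 := by
  rw [mulVec_mulVec, mul_nonsing_inv _ ((isUnit_iff_isUnit_det B).1 hB.isUnit), one_mulVec]

/-- The `i₀`-th coordinate of `u = B⁻¹e_{i₀}` is the diagonal resolvent entry `(B⁻¹)_{i₀i₀}`. -/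
theorem inv_mulVec_single_apply (B : Matrix ι ι ℝ) (i₀ : ι) :
    (B⁻¹ *ᵥ Pi.single i₀ 1) i₀ = (B⁻¹) i₀ i₀ := by
  rw [mulVec_single_one]
  rfl

/-- `(B⁻¹)_{i₀i₀} = uᵀBu` with `u = B⁻¹e_{i₀}` (so it is a value of the quadratic form). -/
theorem inv_apply_self_eq_form (hB : B.PosDef) (i₀ : ι) :
    (B⁻¹) i₀ i₀ = (B⁻¹ *ᵥ Pi.single i₀ 1) ⬝ᵥ (B *ᵥ (B⁻¹ *ᵥ Pi.single i₀ 1)) := by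
  rw [mulVec_inv_mulVec_single hB, dotProduct_single, mul_one, inv_mulVec_single_apply]

/-- The diagonal entries of the inverse of a positive definite real matrix are positive. -/
theorem inv_apply_self_pos (hB : B.PosDef) (i₀ : ι) : 0 < (B⁻¹) i₀ i₀ := by
  rw [inv_apply_self_eq_form hB i₀]
  set u : ι → ℝ := B⁻¹ *ᵥ Pi.single i₀ 1 with hu
  have hu0 : u ≠ 0 := by
    intro h
    have h1 := mulVec_inv_mulVec_single hB i₀
    rw [← hu, h, mulVec_zero] at h1
    have h2 := congrFun h1 i₀
    simp at h2
  have h := hB.dotProduct_mulVec_pos hu0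
  rwa [star_trivial] at h

/-- For `c` with `c_{i₀} = 1`: `cᵀBu = 1`, `u = B⁻¹e_{i₀}`. -/
theorem form_inv_mulVec_single_eq_one (hB : B.PosDef) {i₀ : ι} {c : ι → ℝ} (hc : c i₀ = 1) :
    c ⬝ᵥ (B *ᵥ (B⁻¹ *ᵥ Pi.single i₀ 1)) = 1 := by
  rw [mulVec_inv_mulVec_single hB, dotProduct_single, mul_one, hc]

/-- **The window-floor inequality.**  For a positive definite real matrix `B` and every real vector `c`
with `c_{i₀} = 1`: `cᵀBc ≥ 1/(B⁻¹)_{i₀i₀}`. -/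
theorem form_ge_inv_of_apply_eq_one (hB : B.PosDef) {i₀ : ι} {c : ι → ℝ} (hc : c i₀ = 1) :
    ((B⁻¹) i₀ i₀)⁻¹ ≤ c ⬝ᵥ (B *ᵥ c) := by
  set u : ι → ℝ := B⁻¹ *ᵥ Pi.single i₀ 1 with hu
  set β : ℝ := (B⁻¹) i₀ i₀ with hβ
  have hβpos : 0 < β := inv_apply_self_pos hB i₀
  have hβform : u ⬝ᵥ (B *ᵥ u) = β := (inv_apply_self_eq_form hB i₀).symm
  have hcu : c ⬝ᵥ (B *ᵥ u) = 1 := form_inv_mulVec_single_eq_one hB hc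
  -- 0 ≤ (c − u/β)ᵀ B (c − u/β) = cᵀBc − 2/β + 1/β
  have hnn : 0 ≤ (c - β⁻¹ • u) ⬝ᵥ (B *ᵥ (c - β⁻¹ • u)) := by
    have h := hB.posSemidef.dotProduct_mulVec_nonneg (c - β⁻¹ • u)
    rwa [star_trivial] at h
  rw [form_sub_smul_eq hB.isHermitian, hcu, hβform, mul_one] at hnn
  have e : β⁻¹ ^ 2 * β = β⁻¹ := by
    field_simp
  rw [e] at hnn
  linarith

/-- **The window floor is attained**: `c⋆ := B⁻¹e_{i₀}/(B⁻¹)_{i₀i₀}` has `c⋆_{i₀} = 1` and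
`c⋆ᵀBc⋆ = 1/(B⁻¹)_{i₀i₀}`. -/
theorem exists_form_eq_inv_of_apply_eq_one (hB : B.PosDef) (i₀ : ι) :
    ∃ c : ι → ℝ, c i₀ = 1 ∧ c ⬝ᵥ (B *ᵥ c) = ((B⁻¹) i₀ i₀)⁻¹ := by
  set u : ι → ℝ := B⁻¹ *ᵥ Pi.single i₀ 1 with hu
  set β : ℝ := (B⁻¹) i₀ i₀ with hβ
  have hβpos : 0 < β := inv_apply_self_pos hB i₀
  have hβform : u ⬝ᵥ (B *ᵥ u) = β := (inv_apply_self_eq_form hB i₀).symm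
  refine ⟨β⁻¹ • u, ?_, ?_⟩
  · rw [Pi.smul_apply, smul_eq_mul, hu, inv_mulVec_single_apply, ← hβ, inv_mul_cancel₀ hβpos.ne']
  · rw [mulVec_smul, smul_dotProduct, dotProduct_smul, hβform, smul_eq_mul, smul_eq_mul,
      inv_mul_cancel₀ hβpos.ne', mul_one]

/-- **Variational characterisation of the diagonal resolvent entry**: for a positive definite real matrix
`B`, `1/(B⁻¹)_{i₀i₀}` is the LEAST value of `cᵀBc` over real vectors with `c_{i₀} = 1`. -/
theorem isLeast_form_apply_eq_one (hB : B.PosDef) (i₀ : ι) :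
    IsLeast {q : ℝ | ∃ c : ι → ℝ, c i₀ = 1 ∧ c ⬝ᵥ (B *ᵥ c) = q} ((B⁻¹) i₀ i₀)⁻¹ := by
  refine ⟨?_, ?_⟩
  · obtain ⟨c, hc, hq⟩ := exists_form_eq_inv_of_apply_eq_one hB i₀
    exact ⟨c, hc, hq⟩
  · rintro q ⟨c, hc, rfl⟩
    exact form_ge_inv_of_apply_eq_one hB hc

/-- Equivalently: `(B⁻¹)_{i₀i₀} = 1 / min { cᵀBc : c_{i₀} = 1 }`, the minimum written as an infimum. -/
theorem inv_apply_self_eq_inv_sInf (hB : B.PosDef) (i₀ : ι) :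
    (B⁻¹) i₀ i₀ = (sInf {q : ℝ | ∃ c : ι → ℝ, c i₀ = 1 ∧ c ⬝ᵥ (B *ᵥ c) = q})⁻¹ := by
  rw [(isLeast_form_apply_eq_one hB i₀).csInf_eq, inv_inv]

end PosDef

/-! ### The window form `a‖c‖² − cᵀNc` (PIVOT-LAW 13.3 / 13.10 (v)) -/

/-- The window form is the quadratic form of `a·1 − N`: `cᵀ(a·1 − N)c = a‖c‖² − cᵀNc`. -/
theorem windowForm_eq (N : Matrix ι ι ℝ) (a : ℝ) (c : ι → ℝ) :
    c ⬝ᵥ ((a • (1 : Matrix ι ι ℝ) - N) *ᵥ c) = a * (c ⬝ᵥ c) - c ⬝ᵥ (N *ᵥ c) := by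
  rw [sub_mulVec, smul_mulVec, one_mulVec, dotProduct_sub, dotProduct_smul, smul_eq_mul]

/-- **The per-window floor as a resolvent entry** (PIVOT-LAW 13.10 (v), second identity): if `a·1 − N` is
positive definite (i.e. `a > ν_max(N)` for symmetric `N`), then the least value of `a‖c‖² − cᵀNc` over real
`c` with `c_{i₀} = 1` is `1/((a·1 − N)⁻¹)_{i₀i₀}` — for the von Mangoldt coupling matrix `N_M` and `i₀ = 1` this
is `f_M(a) = 1/[(aI − N_M)⁻¹]₁₁`. -/
theorem isLeast_windowForm (N : Matrix ι ι ℝ) {a : ℝ} (ha : (a • (1 : Matrix ι ι ℝ) - N).PosDef) (i₀ : ι) :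
    IsLeast {q : ℝ | ∃ c : ι → ℝ, c i₀ = 1 ∧ a * (c ⬝ᵥ c) - c ⬝ᵥ (N *ᵥ c) = q}
      (((a • (1 : Matrix ι ι ℝ) - N)⁻¹) i₀ i₀)⁻¹ := by
  have h := isLeast_form_apply_eq_one ha i₀
  have e : {q : ℝ | ∃ c : ι → ℝ, c i₀ = 1 ∧ a * (c ⬝ᵥ c) - c ⬝ᵥ (N *ᵥ c) = q} =
      {q : ℝ | ∃ c : ι → ℝ, c i₀ = 1 ∧ c ⬝ᵥ ((a • (1 : Matrix ι ι ℝ) - N) *ᵥ c) = q} := by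
    ext q
    simp only [Set.mem_setOf_eq, windowForm_eq]
  rw [e]
  exact h

/-- Lower-bound form: `a·1 − N ≻ 0`, `c_{i₀} = 1 ⇒ a‖c‖² − cᵀNc ≥ 1/((a·1 − N)⁻¹)_{i₀i₀}`. -/
theorem windowForm_ge_inv (N : Matrix ι ι ℝ) {a : ℝ} (ha : (a • (1 : Matrix ι ι ℝ) - N).PosDef) {i₀ : ι}
    {c : ι → ℝ} (hc : c i₀ = 1) :
    (((a • (1 : Matrix ι ι ℝ) - N)⁻¹) i₀ i₀)⁻¹ ≤ a * (c ⬝ᵥ c) - c ⬝ᵥ (N *ᵥ c) := by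
  rw [← windowForm_eq]
  exact form_ge_inv_of_apply_eq_one ha hc

/-- A sufficient condition for `a·1 − N ≻ 0` in the form PIVOT-LAW uses it: `N` symmetric with
`cᵀNc ≤ ν‖c‖²` for all `c` (`ν_max(N) ≤ ν`) and `a > ν`. -/
theorem windowMatrix_posDef_of_form_le (N : Matrix ι ι ℝ) (hN : N.IsHermitian) {ν a : ℝ}
    (hform : ∀ c : ι → ℝ, c ⬝ᵥ (N *ᵥ c) ≤ ν * (c ⬝ᵥ c)) (ha : ν < a) :
    (a • (1 : Matrix ι ι ℝ) - N).PosDef := by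
  refine posDef_iff_dotProduct_mulVec.2 ⟨?_, fun x hx => ?_⟩
  · have h1 : (a • (1 : Matrix ι ι ℝ)).IsHermitian := by
      rw [smul_one_eq_diagonal]
      exact isHermitian_diagonal_of_self_adjoint _ (funext fun _ => by simp)
    exact h1.sub hN
  · rw [star_trivial, windowForm_eq]
    have hxx : 0 < x ⬝ᵥ x := by
      rw [← Matrix.dotProduct_star_self_pos_iff] at hx
      simpa using hx
    have h := hform x
    nlinarith

end Summit.RiemannHypothesis.RiemannHypothesis.Theorems.IntegerScrew

end
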